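import Summits.BirchSwinnertonDyer.BirchSwinnertonDyer.Theorems.AlignedTransportAtTwoBSDOfMainConjectureRankOneAtTwoDisegni
import HarnessLib

/-!
# Route `AlignedTransportAtTwo`, crux C3′ `BSDOfMainConjectureRankOneAtTwo` (stmt-BirchSwinnertonDyer-23008), line `birth` v3 — TIGHTNESS:
# on a C3′ cell curve, modulo the four published facts and the crux's own binders (simple zero, `MC(W,2)`), the ONE open input —
# the Schneider leading-term FORMULA at `2` for the characteristic generators, over the canonical `Σ²` height — is EQUIVALENT to `BSD(W,2)`

HONEST FRAMING (cell `bsd-f1-sign2`, lead seat `bsd-line-att-p1` g4). BSD is NOT proved; C3′ is NOT closed. THEOREMS ONLY; nothing asserted;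
`--supports stmt-BirchSwinnertonDyer-23008 --as helper`. Companion of `…Theorems.AlignedTransportAtTwoDisegni` (p609883), whose §3 closes C3′ from
conjunct (3) of `F1Sign2.SchneiderLeadingTermAtTwoSq` (T-23008-a) + Disegni 2020 Thm. 1 + GZK + modularity + Mazur–Tate `Σ²`. Here, PER CURVE:

* §1 `bsdp_of_leadingTermFormulaAtTwoAt_of_disegni` — the per-curve form of that closure: for `W` on the C3′ cell (good ordinary at `2`, `r_an = 1`,
  simple zero of `L₂(f_E)`, `MC(W, 2)`), the leading-term formula for THIS `W` (for every cyclotomic datum, torsion dual, characteristic generator,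
  canonical `Σ²` height, given `Reg₂ ≠ 0` and `Ш[2^∞]` finite) implies `BSDp W 2`.
* §2 `leadingTermFormulaAtTwoAt_of_bsdp` — CONVERSELY, `BSDp W 2` + `MC(W, 2)` + the simple zero + Disegni + GZK + modularity imply that formula
  for THIS `W` (unconditionally in `Reg₂ ≠ 0`, `Ш[2^∞]` finite, which hold): at a cyclotomic datum `char X = (g)`, `ι g = ϖ·L₂`, `g(0) = 0`; any
  generator `f_E` has `[T¹]f_E = v·ϖ·[T¹]L₂`, `v ∈ ℤ₂ˣ` (`exists_unit_coeff_one_eq_mul_of_span_eq_of_iwasawaToPowerSeries_eq`, p594193); Disegni: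
  `ϖ·[T¹]L₂·log₂γ·tors² = ε₂·#Ш_an·Reg₂·Tam`; `BSDp`: `ord₂ #Ш_an = ord₂ #Ш[2^∞]`, and `#Ш_an ≠ 0` (the left side is non-zero by the simple
  zero), so `#Ш_an = u′·#Ш[2^∞]`, `u′ ∈ ℤ₂ˣ`; hence `[T¹]f_E·log₂γ·tors² = (v u′)·ε₂·#Ш[2^∞]·Reg₂·Tam`.
* §3 `leadingTermFormulaAtTwoAt_iff_bsdp` — the equivalence on the cell, modulo {Disegni 2020 Thm. 1, GZK, modularity, Mazur–Tate `Σ²` at `2`}.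
  READING: the v3 reduction of C3′ is LOSSLESS — its open stub, read at the cell's curves, is exactly as strong as the crux's conclusion; in
  particular it cannot be refuted on a cell curve without refuting `BSD(E,2)` there, and no strictly weaker per-curve input closes C3′.

References: [Disegni2020] Thm. 1; [BalakrishnanMullerStein2015] Thm. 1.7 (3); [Schneider1985] Thm. 2′; [Miller2011LMS] Def. 1.1; [GrossZagier1986];
[Kolyvagin1990]; [MazurTate1991] Thm. 3.1.
-/

set_option autoImplicit false
-- the route's Theorems namespace repeats a component by design (summit = sub-problem, D-0017).
set_option linter.dupNamespace false

noncomputable section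

open scoped Classical MatrixGroups ModularForm

open CongruenceSubgroup WeierstrassCurve Literature.NumberTheory.EllipticCurves
  Literature.NumberTheory.EllipticCurves.ModularForms Literature.NumberTheory.EllipticCurves.Greenberg1999
  Summit.BirchSwinnertonDyer.Rank1Residual.F1Sign2
  Summit.BirchSwinnertonDyer.BirchSwinnertonDyer.Theorems.Rank1ResidualX1Defs
  Summit.BirchSwinnertonDyer.BirchSwinnertonDyer.Theorems.AlignedTransportAtTwoOrderTransfer
  Summit.BirchSwinnertonDyer.BirchSwinnertonDyer.Theorems.AlignedTransportAtTwoLeadingTermAlgebra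
  Summit.BirchSwinnertonDyer.BirchSwinnertonDyer.Theorems.AlignedTransportAtTwoDisegni

namespace Summit.BirchSwinnertonDyer.BirchSwinnertonDyer.Theorems.AlignedTransportAtTwoDisegniTight

/-! ## §0 Two small lemmas -/

/-- Equal valuations give equal `p`-adic norms: `q ≠ 0`, `n ≠ 0`, `ord_p q = ord_p n ⟹ ‖q‖_p = ‖n‖_p`. [folklore] -/
theorem norm_ratCast_eq_norm_natCast_of_padicValRat_eq {p : ℕ} [Fact p.Prime] {q : ℚ} {n : ℕ} (hq : q ≠ 0) (hn : n ≠ 0)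
    (h : padicValRat p q = padicValNat p n) : ‖(q : ℚ_[p])‖ = ‖(n : ℚ_[p])‖ := by
  have hn' : (n : ℚ) ≠ 0 := by exact_mod_cast hn
  rw [← Rat.cast_natCast, Padic.eq_padicNorm, Padic.eq_padicNorm, padicNorm.eq_zpow_of_nonzero hq,
    padicNorm.eq_zpow_of_nonzero hn', h, padicValRat.of_nat]

/-- A rational number and a positive integer with the same `p`-adic norm differ by a `p`-adic unit. [folklore] -/
theorem exists_unit_ratCast_eq_mul_natCast {p : ℕ} [Fact p.Prime] {q : ℚ} {n : ℕ} (hn : n ≠ 0)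
    (h : ‖(q : ℚ_[p])‖ = ‖(n : ℚ_[p])‖) : ∃ u : ℤ_[p]ˣ, (q : ℚ_[p]) = ((u : ℤ_[p]) : ℚ_[p]) * (n : ℚ_[p]) := by
  have hnP : (n : ℚ_[p]) ≠ 0 := by exact_mod_cast hn
  have hx : ‖(q : ℚ_[p]) / (n : ℚ_[p])‖ = 1 := by
    rw [norm_div, h, div_self (norm_ne_zero_iff.mpr hnP)]
  obtain ⟨u, hu⟩ := exists_unit_coe_eq_of_norm_eq_one p hx
  exact ⟨u, by rw [hu, div_mul_cancel₀ _ hnP]⟩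

/-! ## §1 Per curve: the leading-term formula at `2` ⇒ `BSD(W,2)` on the C3′ cell -/

/-- **Per-curve closure (CONDITIONAL; closes nothing).** For `W` globally minimal, good ordinary at `2`, of analytic rank one, with a simple zero of
`L₂(f_E)` at `T = 0` for every conductor-level newform and `MazurMainConjecture W 2`: the leading-term formula AT THIS `W` (conjunct (3) of T-23008-a
specialised to `W`) together with Disegni 2020 Thm. 1, GZK, modularity and the Mazur–Tate `Σ²` series gives `BSDp W 2` (same proof as
`…AlignedTransportAtTwoDisegni.bsdOfMainConjectureRankOneAtTwo_of_leadingTermFormulaAtTwo_of_disegni`, per curve).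
[cite: BalakrishnanMullerStein2015, Thm. 1.7 (3)] [cite: Disegni2020, Thm. 1] [cite: Miller2011LMS, Def. 1.1] -/
theorem bsdp_of_leadingTermFormulaAtTwoAt_of_disegni (hD : Disegni2020.padicBSD_goodOrd_rankOne)
    (hGZK : rank_eq_analyticRank_of_analyticRank_le_one) (hmod : nonempty_modularParametrizationData)
    (hMT : mazurTate_sigmaSq_existsUnique_two)
    (W : WeierstrassCurve ℚ) [W.IsElliptic] [W.IsGloballyMinimal] (hord : IsOrdinaryAt W 2) (hr : W.analyticRank = 1)
    (hL : ∀ [NeZero (W.conductorNorm ℤ)] (f : CuspForm (Gamma0 (W.conductorNorm ℤ)) 2), IsNewformOf W f →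
      (padicLFunction f (unitRoot W 2 : ℚ_[2])).order = 1)
    (hMC : MazurMainConjecture W 2)
    (ha3 : ∀ (κ : ZpExtension ℚ 2) (γ : Field.absoluteGaloisGroup ℚ),
        κ.IsCyclotomic → κ.IsTopGenerator γ → IsCyclotomicVariable 2 γ →
      ∀ (D : W.SelmerDualData κ γ) [Module.Finite (IwasawaAlgebra 2) D.X], D.IsTorsion →
      ∀ (fE : IwasawaAlgebra 2), D.charIdeal = Ideal.span {fE} →
      ∀ (Dh : PAdicHeightData W 2), Dh.IsCanonicalSq →
        SchneiderConjecture Dh → Finite (AddCommGroup.primaryComponent W.sha 2) →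
        ∃ u : ℤ_[2]ˣ,
          ((PowerSeries.coeff W.mordellWeilRank fE : ℤ_[2]) : ℚ_[2]) *
              padicLog 2 (cyclotomicGenerator 2) ^ W.mordellWeilRank * (W.torsionOrder : ℚ_[2]) ^ 2 =
            ((u : ℤ_[2]) : ℚ_[2]) *
              ((1 - (unitRoot W 2 : ℚ_[2])⁻¹) ^ 2 *
                ((Nat.card (AddCommGroup.primaryComponent W.sha 2) : ℚ_[2]) * padicRegulator Dh * W.tamagawaProduct))) :
    BSDp W 2 := by
  haveI : NeZero (W.conductorNorm ℤ) := ⟨(W.conductorNorm_pos_holds).ne'⟩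
  obtain ⟨hrank, hfinSha⟩ := hGZK W (le_of_eq hr)
  have hrank1 : W.mordellWeilRank = 1 := by rw [hrank, hr]
  haveI : Finite W.sha := hfinSha
  have hfin2 : Finite (AddCommGroup.primaryComponent W.sha 2) := inferInstance
  obtain ⟨Dm⟩ := hmod W
  obtain ⟨ϖ, _, hϖ, -⟩ := Dm.exists_rat_mul_realPeriodRat_eq_plusPeriod
  have hf : IsNewformOf W Dm.f := Dm.isNewformOf
  have hL1 : (padicLFunction Dm.f (unitRoot W 2 : ℚ_[2])).order = 1 := hL Dm.f hf
  obtain ⟨Dh, hDh⟩ := exists_isCanonicalSq_two hMT W hord.1 hord.2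
  have hSch : SchneiderConjecture Dh := schneiderConjecture_of_disegni_of_order_eq_one hD W hord hr hf hϖ hL1 hDh
  set ε : ℚ_[2] := (1 - (unitRoot W 2 : ℚ_[2])⁻¹) ^ 2 with hε
  have hε0 : ε ≠ 0 := by
    obtain ⟨u₂, hu₂⟩ := exists_unit_one_sub_unitRoot_inv 2 W hord
    have hN : (W.reductionPointCount 2 : ℚ_[2]) ≠ 0 := by exact_mod_cast (W.reductionPointCount_pos 2).ne'
    have hu1 : ‖((u₂ : ℤ_[2]) : ℚ_[2])‖ = 1 := PadicInt.isUnit_iff.mp u₂.isUnit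
    have hu0 : ((u₂ : ℤ_[2]) : ℚ_[2]) ≠ 0 := by
      rw [← norm_pos_iff, hu1]; exact one_pos
    rw [hε, hu₂]
    exact pow_ne_zero 2 (mul_ne_zero hu0 hN)
  have hB : ε * padicRegulator Dh ≠ 0 := mul_ne_zero hε0 hSch
  have hS : ∀ (κ : ZpExtension ℚ 2) (γ : Field.absoluteGaloisGroup ℚ),
      κ.IsCyclotomic → κ.IsTopGenerator γ → IsCyclotomicVariable 2 γ →
      ∀ (D : W.SelmerDualData κ γ) [Module.Finite (IwasawaAlgebra 2) D.X], D.IsTorsion →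
      ∀ fE : IwasawaAlgebra 2, D.charIdeal = Ideal.span {fE} → fE.order = (W.mordellWeilRank : ℕ∞) →
        ∃ u : ℤ_[2]ˣ, ((PowerSeries.coeff 1 fE : ℤ_[2]) : ℚ_[2]) * padicLog 2 (cyclotomicGenerator 2) *
            (W.torsionOrder : ℚ_[2]) ^ 2 =
          ((u : ℤ_[2]) : ℚ_[2]) * (Nat.card (AddCommGroup.primaryComponent W.sha 2) : ℚ_[2]) * (ε * padicRegulator Dh) *
            (W.tamagawaProduct : ℚ_[2]) := by
    intro κ γ hκ hγ hγ' D _ hX fE hchar _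
    obtain ⟨u, hu⟩ := ha3 κ γ hκ hγ hγ' D hX fE hchar Dh hDh hSch hfin2
    rw [hrank1, pow_one] at hu
    exact ⟨u, by rw [hu]; ring⟩
  have hLT := leadingTermLaw_of_schneiderShape_of_mazurMainConjecture W 2 hf hϖ hS hrank1 hL1 hMC
  obtain ⟨q, hq1, hq2⟩ := perrinRiouComparisonAtTwo_exact_of_disegni hD W hord hr hf hϖ hDh
  exact bsdp_of_leadingTerm_of_comparison W 2 hGZK (le_of_eq hr) hB hLT ⟨q, hq1, hq2⟩

/-! ## §2 Per curve: `BSD(W,2)` ⇒ the leading-term formula at `2` for every characteristic generator -/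

/-- **The converse on the cell (CONDITIONAL; closes nothing).** For `W` good ordinary at `2`, of analytic rank one, with a simple zero of `L₂(f_E)`
and `MazurMainConjecture W 2`: IF `BSDp W 2` holds then, for every cyclotomic datum, every torsion Selmer dual with characteristic generator `f_E`
and every canonical `Σ²` height `Dh`, `[T^r]f_E · (log₂ γ)^r · tors² = u · (1 − α⁻¹)² · #Ш[2^∞] · Reg₂(Dh) · ∏ c_v` with `u ∈ ℤ₂ˣ` (`r = rank = 1`) —
from Disegni 2020 Thm. 1, GZK and modularity: `f_E = v·g` up to the unit `v` for the main-conjecture generator `g` (`ι g = ϖ·L₂`, `g(0) = 0`), so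
`[T¹]f_E = v·ϖ·[T¹]L₂`; Disegni gives `ϖ·[T¹]L₂·log₂γ·tors² = ε₂·#Ш_an·Reg₂·Tam` with `#Ш_an ≠ 0`; `BSDp` gives `ord₂ #Ш_an = ord₂ #Ш[2^∞]`,
hence `#Ш_an = u′·#Ш[2^∞]` with `u′ ∈ ℤ₂ˣ`. [cite: Disegni2020, Thm. 1] [cite: Miller2011LMS, Def. 1.1] [cite: Schneider1985, Thm. 2′ (the formula's shape)] -/
theorem leadingTermFormulaAtTwoAt_of_bsdp (hD : Disegni2020.padicBSD_goodOrd_rankOne)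
    (hGZK : rank_eq_analyticRank_of_analyticRank_le_one) (hmod : nonempty_modularParametrizationData)
    (W : WeierstrassCurve ℚ) [W.IsElliptic] [W.IsGloballyMinimal] (hord : IsOrdinaryAt W 2) (hr : W.analyticRank = 1)
    (hL : ∀ [NeZero (W.conductorNorm ℤ)] (f : CuspForm (Gamma0 (W.conductorNorm ℤ)) 2), IsNewformOf W f →
      (padicLFunction f (unitRoot W 2 : ℚ_[2])).order = 1)
    (hMC : MazurMainConjecture W 2) (hBSD : BSDp W 2) :
    ∀ (κ : ZpExtension ℚ 2) (γ : Field.absoluteGaloisGroup ℚ),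
        κ.IsCyclotomic → κ.IsTopGenerator γ → IsCyclotomicVariable 2 γ →
      ∀ (D : W.SelmerDualData κ γ) [Module.Finite (IwasawaAlgebra 2) D.X], D.IsTorsion →
      ∀ (fE : IwasawaAlgebra 2), D.charIdeal = Ideal.span {fE} →
      ∀ (Dh : PAdicHeightData W 2), Dh.IsCanonicalSq →
        ∃ u : ℤ_[2]ˣ,
          ((PowerSeries.coeff W.mordellWeilRank fE : ℤ_[2]) : ℚ_[2]) *
              padicLog 2 (cyclotomicGenerator 2) ^ W.mordellWeilRank * (W.torsionOrder : ℚ_[2]) ^ 2 =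
            ((u : ℤ_[2]) : ℚ_[2]) *
              ((1 - (unitRoot W 2 : ℚ_[2])⁻¹) ^ 2 *
                ((Nat.card (AddCommGroup.primaryComponent W.sha 2) : ℚ_[2]) * padicRegulator Dh * W.tamagawaProduct)) := by
  intro κ γ hκ hγ hγ' D _ _ fE hchar Dh hDh
  haveI : NeZero (W.conductorNorm ℤ) := ⟨(W.conductorNorm_pos_holds).ne'⟩
  obtain ⟨hrank, hfinSha⟩ := hGZK W (le_of_eq hr)
  have hrank1 : W.mordellWeilRank = 1 := by rw [hrank, hr]
  haveI : Finite W.sha := hfinSha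
  have hn0 : Nat.card (AddCommGroup.primaryComponent W.sha 2) ≠ 0 := Nat.card_pos.ne'
  -- the conductor-level newform and its period ratio (modularity datum)
  obtain ⟨Dm⟩ := hmod W
  obtain ⟨ϖ, hϖpos, hϖ, -⟩ := Dm.exists_rat_mul_realPeriodRat_eq_plusPeriod
  have hf : IsNewformOf W Dm.f := Dm.isNewformOf
  have hL1 : (padicLFunction Dm.f (unitRoot W 2 : ℚ_[2])).order = 1 := hL Dm.f hf
  have hc : (ϖ : ℚ_[2]) ≠ 0 := by exact_mod_cast hϖpos.ne'
  -- the main-conjecture generator `g` at this datum; `g(0) = 0`; `[T¹]fE = v · ϖ · [T¹]L₂`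
  obtain ⟨-, g, hcharg, hι⟩ := hMC κ γ hκ hγ hγ' Dm.f hf ϖ hϖ D
  have hspan : Ideal.span ({fE} : Set (IwasawaAlgebra 2)) = Ideal.span {g} := hchar.symm.trans hcharg
  have hordg : g.order = 1 := by
    rw [← order_eq_order_of_iwasawaToPowerSeries_eq_C_mul 2 hc hι, hL1]
  have hg0 : PowerSeries.constantCoeff g = 0 := by
    have h := PowerSeries.coeff_of_lt_order 0 (φ := g) (by rw [hordg]; exact_mod_cast zero_lt_one)
    simpa only [PowerSeries.coeff_zero_eq_constantCoeff] using h
  obtain ⟨v, hv⟩ := exists_unit_coeff_one_eq_mul_of_span_eq_of_iwasawaToPowerSeries_eq hspan hg0 hι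
  -- Disegni's identity for the canonical height
  obtain ⟨qD, hsha, hid⟩ := hD W 2 hord hr
  have hI := hid Dh hDh Dm.f hf ϖ hϖ
  -- `#Ш_an ≠ 0`: the left side of Disegni's identity is non-zero (simple zero)
  have h1 : PowerSeries.coeff 1 (padicLFunction Dm.f (unitRoot W 2 : ℚ_[2])) ≠ 0 :=
    (order_padicLFunction_eq_one_iff_coeff_one_ne_zero W 2 hord hf hr).mp hL1
  have hlog : padicLog 2 (cyclotomicGenerator 2 : ℚ_[2]) ≠ 0 :=
    Literature.Barriers.BirchSwinnertonDyer.padicLog_cyclotomicGenerator_ne_zero 2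
  have htP : (W.torsionOrder : ℚ_[2]) ≠ 0 := by exact_mod_cast (W.torsionOrder_pos_holds).ne'
  have hLHS : (ϖ : ℚ_[2]) * PowerSeries.coeff 1 (padicLFunction Dm.f (unitRoot W 2 : ℚ_[2])) *
      padicLog 2 (cyclotomicGenerator 2) * (W.torsionOrder : ℚ_[2]) ^ 2 ≠ 0 :=
    mul_ne_zero (mul_ne_zero (mul_ne_zero hc h1) hlog) (pow_ne_zero 2 htP)
  have hqD0 : qD ≠ 0 := by
    rintro rfl
    apply hLHS
    rw [hI]; simp
  -- `BSDp`: the rational witness is `#Ш_an = qD`, and `ord₂ qD = ord₂ #Ш[2^∞]`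
  obtain ⟨-, -, q, hq, hval⟩ := hBSD
  have hqq : q = qD := by
    have h := hq.symm.trans hsha
    exact_mod_cast h
  rw [hqq] at hval
  obtain ⟨u', hu'⟩ := exists_unit_ratCast_eq_mul_natCast hn0
    (norm_ratCast_eq_norm_natCast_of_padicValRat_eq hqD0 hn0 hval)
  -- assemble
  refine ⟨v * u', ?_⟩
  rw [hrank1, pow_one, hv]
  calc ((v : ℤ_[2]) : ℚ_[2]) * ((ϖ : ℚ_[2]) * PowerSeries.coeff 1 (padicLFunction Dm.f (unitRoot W 2 : ℚ_[2]))) *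
          padicLog 2 (cyclotomicGenerator 2) * (W.torsionOrder : ℚ_[2]) ^ 2
        = ((v : ℤ_[2]) : ℚ_[2]) * ((ϖ : ℚ_[2]) * PowerSeries.coeff 1 (padicLFunction Dm.f (unitRoot W 2 : ℚ_[2])) *
          padicLog 2 (cyclotomicGenerator 2) * (W.torsionOrder : ℚ_[2]) ^ 2) := by ring
    _ = ((v : ℤ_[2]) : ℚ_[2]) * ((1 - (unitRoot W 2 : ℚ_[2])⁻¹) ^ 2 *
          (((u' : ℤ_[2]) : ℚ_[2]) * (Nat.card (AddCommGroup.primaryComponent W.sha 2) : ℚ_[2]) *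
            padicRegulator Dh * W.tamagawaProduct)) := by rw [hI, hu']
    _ = (((v * u' : ℤ_[2]ˣ) : ℤ_[2]) : ℚ_[2]) * ((1 - (unitRoot W 2 : ℚ_[2])⁻¹) ^ 2 *
          ((Nat.card (AddCommGroup.primaryComponent W.sha 2) : ℚ_[2]) * padicRegulator Dh * W.tamagawaProduct)) := by
      push_cast; ring

/-! ## §3 Per curve: the equivalence on the C3′ cell -/

/-- **TIGHTNESS of line `birth` v3 of crux C3′ (CONDITIONAL; closes nothing).** For `W` globally minimal, good ordinary at `2`, analytic rank one,
simple zero of `L₂(f_E)` at `T = 0`, `MazurMainConjecture W 2` — the binders of the crux — and modulo the published inputs Disegni 2020 Thm. 1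
(`hD`), Gross–Zagier–Kolyvagin (`hGZK`), modularity (`hmod`), Mazur–Tate `Σ²` at `2` (`hMT`): the leading-term formula at `2` for THIS `W`
(conjunct (3) of T-23008-a specialised to `W`) holds IF AND ONLY IF `BSDp W 2`. So the open stub of C3′, read curve by curve on the cell, is
exactly as strong as the crux's conclusion. [cite: Disegni2020, Thm. 1] [cite: BalakrishnanMullerStein2015, Thm. 1.7 (3)] [cite: Miller2011LMS, Def. 1.1] -/
theorem leadingTermFormulaAtTwoAt_iff_bsdp (hD : Disegni2020.padicBSD_goodOrd_rankOne)
    (hGZK : rank_eq_analyticRank_of_analyticRank_le_one) (hmod : nonempty_modularParametrizationData)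
    (hMT : mazurTate_sigmaSq_existsUnique_two)
    (W : WeierstrassCurve ℚ) [W.IsElliptic] [W.IsGloballyMinimal] (hord : IsOrdinaryAt W 2) (hr : W.analyticRank = 1)
    (hL : ∀ [NeZero (W.conductorNorm ℤ)] (f : CuspForm (Gamma0 (W.conductorNorm ℤ)) 2), IsNewformOf W f →
      (padicLFunction f (unitRoot W 2 : ℚ_[2])).order = 1)
    (hMC : MazurMainConjecture W 2) :
    (∀ (κ : ZpExtension ℚ 2) (γ : Field.absoluteGaloisGroup ℚ),
        κ.IsCyclotomic → κ.IsTopGenerator γ → IsCyclotomicVariable 2 γ →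
      ∀ (D : W.SelmerDualData κ γ) [Module.Finite (IwasawaAlgebra 2) D.X], D.IsTorsion →
      ∀ (fE : IwasawaAlgebra 2), D.charIdeal = Ideal.span {fE} →
      ∀ (Dh : PAdicHeightData W 2), Dh.IsCanonicalSq →
        SchneiderConjecture Dh → Finite (AddCommGroup.primaryComponent W.sha 2) →
        ∃ u : ℤ_[2]ˣ,
          ((PowerSeries.coeff W.mordellWeilRank fE : ℤ_[2]) : ℚ_[2]) *
              padicLog 2 (cyclotomicGenerator 2) ^ W.mordellWeilRank * (W.torsionOrder : ℚ_[2]) ^ 2 =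
            ((u : ℤ_[2]) : ℚ_[2]) *
              ((1 - (unitRoot W 2 : ℚ_[2])⁻¹) ^ 2 *
                ((Nat.card (AddCommGroup.primaryComponent W.sha 2) : ℚ_[2]) * padicRegulator Dh * W.tamagawaProduct))) ↔
    BSDp W 2 :=
  ⟨fun h ↦ bsdp_of_leadingTermFormulaAtTwoAt_of_disegni hD hGZK hmod hMT W hord hr hL hMC h,
   fun h κ γ hκ hγ hγ' D _ hX fE hchar Dh hDh _ _ ↦
     leadingTermFormulaAtTwoAt_of_bsdp hD hGZK hmod W hord hr hL hMC h κ γ hκ hγ hγ' D hX fE hchar Dh hDh⟩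

end Summit.BirchSwinnertonDyer.BirchSwinnertonDyer.Theorems.AlignedTransportAtTwoDisegniTight

end
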